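import Mathlib
import HarnessLib
import Summits.AtomisticToContinuum.FouriersLaw.Theses.OddSectorIrreversibility

/-!
# Crux SubBallisticWindow (stmt-AtomisticToContinuum-14070) — ideator 2 sketch (round 1)

First lemmas for the two crux idea cards of this seat:

* card `tent-equivalence`: the windowed second moment `Vw c τ = ∫ (∫₀^τ (Σ cᵢ jᵢ)∘Φ_t)² dμ_T` is a
  QUADRATIC form of the weight vector `c`, so adjacent blocks obey the L²-parallelogram identity
  `V(B₁∪B₂) + V(1_{B₁} − 1_{B₂}) = 2V(B₁) + 2V(B₂)` (`parallelogramStep`, PROVED below from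
  pointwise additivity + square-integrability); telescoped dyadically it makes `SubBallisticWindow`
  EQUIVALENT to the two tent laws `TentLaw` (adjacent equal blocks, compactly supported primitive =
  tent energy observable) and `EndTentLaw` (blocks touching a free end); shape theorem
  `subBallisticWindow_of_tents` (sorried: bookkeeping of the telescoping, M-sized).
* card `open-corrector-shadow`: `BlockConeScaleCorrector` (E1 for block currents, bound C·|B|·N·Z —
  its |B| = N−1 instance is the route's rank-2 crux `ConeScaleCorrector`), `OpenClosedCone`
  (inside the light cone the open finite-horizon block corrector and the closed windowed transport
  agree in L²(μ_T)), `ClosedKinematics` (cut locality + sub-block decoupling + smoothing: E2 on cone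
  pairs at every chain length ⇒ `TentLawCone`), the route-irrelevant remainders `TentLawBox`,
  `EndTentLaw`, shape theorem `subBallisticWindow_of_shadow` (sorried).
-/

namespace Summit.AtomisticToContinuum.FouriersLaw.Cruxes.SubBallisticWindow.Ideator2

open MeasureTheory
open Literature.MathematicalPhysics.KineticTheory.HeatConduction

noncomputable section

/-- unnormalised Gibbs weight `μ_T = e^{-H_N/T} dq dp` (the Hamiltonian does not depend on `γ`). -/
def gibbsW (ω₂ lam β γ T : ℝ) (N : ℕ) : Measure (PhaseSpace N) :=
  volume.withDensity (fun x => ENNReal.ofReal (Real.exp (-((pinnedChain ω₂ lam β γ).hamiltonian N x) / T)))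

/-- its mass `Z`. -/
def partZ (ω₂ lam β γ T : ℝ) (N : ℕ) : ℝ :=
  ∫ x, Real.exp (-((pinnedChain ω₂ lam β γ).hamiltonian N x) / T)

/-- weighted bond current `Σ_i c_i j_i`. -/
def Jw (ω₂ lam β γ : ℝ) (N : ℕ) (c : Fin N → ℝ) (z : PhaseSpace N) : ℝ :=
  ∑ i : Fin N, c i * (pinnedChain ω₂ lam β γ).bondCurrent N i z

/-- CLOSED-chain windowed transport `Q_τ(c)(x) = ∫₀^τ (Σ cᵢ jᵢ)(Φ_t x) dt` (zero-friction kernels). -/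
def Qw (ω₂ lam β γ T : ℝ) (N : ℕ) (c : Fin N → ℝ) (τ : ℝ) (x : PhaseSpace N) : ℝ :=
  ∫ t in Set.Ioc (0:ℝ) τ, ∫ y, Jw ω₂ lam β γ N c y ∂((pinnedChain ω₂ lam β 0).transitionKernel N T T t.toNNReal x)

/-- windowed second moment `V(c, τ) = ∫ Q_τ(c)² dμ_T`. For `c = 1_{[k₁,k₂)}` this is the left side
of `SubBallisticWindow`. -/
def Vw (ω₂ lam β γ T : ℝ) (N : ℕ) (c : Fin N → ℝ) (τ : ℝ) : ℝ :=
  ∫ x, (Qw ω₂ lam β γ T N c τ x) ^ 2 ∂(gibbsW ω₂ lam β γ T N)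

/-- indicator weights of the block of bonds `[k₁, k₂)`. -/
def blockInd (N k₁ k₂ : ℕ) : Fin N → ℝ := fun i => if k₁ ≤ i.val ∧ i.val < k₂ then 1 else 0

/-- TENT LAW (adjacent equal blocks): the difference of the windowed transports of the two adjacent
blocks `[c-L, c)` and `[c, c+L)` — whose primitive along the flow is the compactly supported tent
energy observable `Λ_{L,c} = Σ_m (L - |m - c|)₊ e_m` — has second moment ≤ C·(1+τ)·L·Z, uniformly.
Trivial for τ ≤ 1 (continuity) and for τ ≥ L²/c (saturation at 2Var(Λ_L) ≲ L³); content in between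
(= at-most-diffusive mean-square displacement of energy correlations). -/
def TentLaw : Prop :=
  ∀ ω₂ lam β γ : ℝ, 0 < ω₂ → 0 < lam → 0 < β → 0 < γ → ∀ T : ℝ, 0 < T → ∃ C : ℝ,
    ∀ (N c L : ℕ), L ≤ c → c + L + 1 ≤ N → ∀ τ : ℝ, 0 ≤ τ →
      Vw ω₂ lam β γ T N (blockInd N (c - L) c - blockInd N c (c + L)) τ
        ≤ C * (1 + τ) * (L : ℝ) * partZ ω₂ lam β γ T N

/-- END-TENT LAW: blocks touching the right free end `[k, N-1)` (primitive = half-tent against the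
wall, compactly supported) and, symmetrically, the left end `[0, k)`. -/
def EndTentLaw : Prop :=
  ∀ ω₂ lam β γ : ℝ, 0 < ω₂ → 0 < lam → 0 < β → 0 < γ → ∀ T : ℝ, 0 < T → ∃ C : ℝ,
    ∀ (N k : ℕ), k + 1 ≤ N → ∀ τ : ℝ, 0 ≤ τ →
      Vw ω₂ lam β γ T N (blockInd N k (N - 1)) τ ≤ C * (1 + τ) * ((N : ℝ) - 1 - k) * partZ ω₂ lam β γ T N ∧
      Vw ω₂ lam β γ T N (blockInd N 0 k) τ ≤ C * (1 + τ) * (k : ℝ) * partZ ω₂ lam β γ T N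

/-- TENT LAW INSIDE THE LIGHT CONE: tents whose support keeps a margin `d` from both free ends,
windows `τ ≤ a·d` (for every slope `a`, some constant). This is the part of `TentLaw` that
infinite-volume physics (MSD ≤ Cτ) and the open-corrector shadow can reach. -/
def TentLawCone : Prop :=
  ∀ ω₂ lam β γ : ℝ, 0 < ω₂ → 0 < lam → 0 < β → 0 < γ → ∀ T : ℝ, 0 < T → ∀ a : ℝ, 0 < a → ∃ C : ℝ,
    ∀ (N c L d : ℕ), L + d ≤ c → c + L + d + 1 ≤ N → ∀ τ : ℝ, 0 ≤ τ → τ ≤ a * d →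
      Vw ω₂ lam β γ T N (blockInd N (c - L) c - blockInd N c (c + L)) τ
        ≤ C * (1 + τ) * (L : ℝ) * partZ ω₂ lam β γ T N

/-- TENT LAW BEYOND THE CONE ("box" part: the window exceeds `a ×` every admissible margin — energy
has bounced off a free end; automatic again for τ ≳ L² by saturation). Route-irrelevant
(`WitnessGlue` uses cone pairs only) but part of the crux as filed. -/
def TentLawBox : Prop :=
  ∀ ω₂ lam β γ : ℝ, 0 < ω₂ → 0 < lam → 0 < β → 0 < γ → ∀ T : ℝ, 0 < T → ∃ a C : ℝ, 0 < a ∧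
    ∀ (N c L : ℕ), L ≤ c → c + L + 1 ≤ N → ∀ τ : ℝ, 0 ≤ τ →
      (∀ d : ℕ, L + d ≤ c → c + L + d + 1 ≤ N → a * d < τ) →
      Vw ω₂ lam β γ T N (blockInd N (c - L) c - blockInd N c (c + L)) τ
        ≤ C * (1 + τ) * (L : ℝ) * partZ ω₂ lam β γ T N

/-- cone ∧ box ⇒ the full tent law (case split on the maximal margin; bookkeeping). -/
theorem tentLaw_of_cone_box : TentLawCone → TentLawBox → TentLaw := by
  sorry

/-- Parallelogram law for second moments (pure measure theory): if `s = f + g` and `d = f - g`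
pointwise with `f, g ∈ L²(μ)`, then `∫ s² + ∫ d² = 2∫ f² + 2∫ g²`. -/
theorem parallelogram_sq_integral {α : Type*} [MeasurableSpace α] (μ : Measure α)
    (f g s d : α → ℝ) (hf : MemLp f 2 μ) (hg : MemLp g 2 μ)
    (hs : ∀ x, s x = f x + g x) (hd : ∀ x, d x = f x - g x) :
    (∫ x, (s x) ^ 2 ∂μ) + ∫ x, (d x) ^ 2 ∂μ = 2 * (∫ x, (f x) ^ 2 ∂μ) + 2 * ∫ x, (g x) ^ 2 ∂μ := by
  have hs' : (fun x => (s x) ^ 2) = fun x => ((f x) ^ 2 + (g x) ^ 2) + 2 * (f x * g x) := by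
    funext x; rw [hs x]; ring
  have hd' : (fun x => (d x) ^ 2) = fun x => ((f x) ^ 2 + (g x) ^ 2) - 2 * (f x * g x) := by
    funext x; rw [hd x]; ring
  have I1 : Integrable (fun x => (f x) ^ 2) μ := hf.integrable_sq
  have I2 : Integrable (fun x => (g x) ^ 2) μ := hg.integrable_sq
  have I12 : Integrable (fun x => f x * g x) μ := hf.integrable_mul hg
  have Isum : Integrable (fun x => (f x) ^ 2 + (g x) ^ 2) μ := I1.add I2
  have I12c : Integrable (fun x => 2 * (f x * g x)) μ := I12.const_mul 2
  rw [hs', hd', integral_add Isum I12c, integral_sub Isum I12c, integral_add I1 I2]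
  ring

/-- PARALLELOGRAM STEP (fixed N, pure L² algebra): for weight vectors `c₁ c₂` whose windowed
transports are square-integrable and add pointwise, `V(c₁+c₂) + V(c₁-c₂) = 2V(c₁) + 2V(c₂)`.
With `c₁ = 1_{[k₁,k₂)}`, `c₂ = 1_{[k₂,k₃)}`: `V(B₁∪B₂) = 2V(B₁) + 2V(B₂) − R(B₁,B₂)`, `R ≥ 0` the
tent term. (Pointwise additivity of `Qw` in `c` holds because the zero-friction kernels are Dirac
masses along a continuous flow; square-integrability because `|Qw| ≤ τ·sup_t |J(Φ_t x)|` is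
polynomially bounded by energy conservation — both routine, kept as hypotheses here.) -/
theorem parallelogramStep (ω₂ lam β γ T : ℝ) (N : ℕ) (c₁ c₂ : Fin N → ℝ) (τ : ℝ)
    (h₁ : MemLp (Qw ω₂ lam β γ T N c₁ τ) 2 (gibbsW ω₂ lam β γ T N))
    (h₂ : MemLp (Qw ω₂ lam β γ T N c₂ τ) 2 (gibbsW ω₂ lam β γ T N))
    (hadd : ∀ x, Qw ω₂ lam β γ T N (c₁ + c₂) τ x = Qw ω₂ lam β γ T N c₁ τ x + Qw ω₂ lam β γ T N c₂ τ x)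
    (hsub : ∀ x, Qw ω₂ lam β γ T N (c₁ - c₂) τ x = Qw ω₂ lam β γ T N c₁ τ x - Qw ω₂ lam β γ T N c₂ τ x) :
    Vw ω₂ lam β γ T N (c₁ + c₂) τ + Vw ω₂ lam β γ T N (c₁ - c₂) τ
      = 2 * Vw ω₂ lam β γ T N c₁ τ + 2 * Vw ω₂ lam β γ T N c₂ τ := by
  simp only [Vw]
  exact parallelogram_sq_integral (gibbsW ω₂ lam β γ T N) _ _ _ _ h₁ h₂ hadd hsub

/-- SHAPE (card `tent-equivalence`): the two tent laws give the crux, by telescoping the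
parallelogram step dyadically (`V_L = Σ_{i<J} 4^{-1-i} R_{2^i L} + 4^{-J} V_{2^J L}`, top block
bounded through the end tents); constants: C_E2 ≤ C_tent/2 + 8·C_end. Converse: R ≤ 2V+2V and
end blocks are blocks, so the crux implies both laws. -/
theorem subBallisticWindow_of_tents :
    TentLaw → EndTentLaw →
      Summit.AtomisticToContinuum.FouriersLaw.Theses.OddSectorIrreversibility.SubBallisticWindow := by
  sorry

/-! ### card `open-corrector-shadow` -/

/-- E1 FOR BLOCKS (C⁺ of card `open-corrector-shadow`; its block `[0, N-1)` instance is the route's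
rank-2 crux `ConeScaleCorrector` with the same constant): every a.e.-limit `u` of the finite-horizon
OPEN-chain correctors of the block current `J_B` satisfies `∫ u² dμ_T ≤ C·|B|·N·Z`. -/
def BlockConeScaleCorrector : Prop :=
  ∀ ω₂ lam β γ : ℝ, 0 < ω₂ → 0 < lam → 0 < β → 0 < γ → ∀ T : ℝ, 0 < T → ∃ C : ℝ,
    ∀ (N k₁ k₂ : ℕ) (u : PhaseSpace N → ℝ), k₁ ≤ k₂ → k₂ + 1 ≤ N →
      (∀ᵐ x ∂(gibbsW ω₂ lam β γ T N), Filter.Tendsto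
          (fun τ : ℝ => ∫ t in Set.Ioc (0:ℝ) τ, ∫ y, Jw ω₂ lam β γ N (blockInd N k₁ k₂) y
              ∂((pinnedChain ω₂ lam β γ).transitionKernel N T T t.toNNReal x))
          Filter.atTop (nhds (u x))) →
      MemLp u 2 (gibbsW ω₂ lam β γ T N) ∧
        ∫ x, (u x) ^ 2 ∂(gibbsW ω₂ lam β γ T N) ≤ C * ((k₂ : ℝ) - k₁) * (N : ℝ) * partZ ω₂ lam β γ T N

/-- OPEN = CLOSED INSIDE THE CONE (kinematic; Duhamel through the two Ornstein–Uhlenbeck taps + an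
L² light cone of the closed flow for first and second contact-momentum derivatives): for a block at
distance `d` from both contacts and a window `τ ≤ a·d`, the open finite-horizon block corrector and
the closed windowed transport differ in `L²(μ_T)` by an exponentially small amount. -/
def OpenClosedCone : Prop :=
  ∀ ω₂ lam β γ : ℝ, 0 < ω₂ → 0 < lam → 0 < β → 0 < γ → ∀ T : ℝ, 0 < T → ∃ a κ C : ℝ, 0 < a ∧ 0 < κ ∧
    ∀ (N k₁ k₂ d : ℕ) (τ : ℝ), k₁ ≤ k₂ → k₂ + 1 ≤ N → d ≤ k₁ → k₂ + d + 1 ≤ N → 0 ≤ τ → τ ≤ a * d →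
      ∫ x, ((∫ t in Set.Ioc (0:ℝ) τ, ∫ y, Jw ω₂ lam β γ N (blockInd N k₁ k₂) y
              ∂((pinnedChain ω₂ lam β γ).transitionKernel N T T t.toNNReal x))
            - Qw ω₂ lam β γ T N (blockInd N k₁ k₂) τ x) ^ 2 ∂(gibbsW ω₂ lam β γ T N)
        ≤ C * ((k₂ : ℝ) - k₁) * Real.exp (-(κ * ((d : ℝ) - τ / a))) * partZ ω₂ lam β γ T N

/-- CLOSED-CHAIN KINEMATICS + STATICS (cut locality, sub-block decoupling by the closed light cone
and Gibbs spatial mixing, Rost–Vares smoothing below the Thouless diagonal, saturation beyond it):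
E2 restricted to CONE PAIRS — blocks at distance ≥ d from both ends with windows τ ≤ a·d, bound
C·|B|·N·Z, at EVERY chain length — implies the tent law INSIDE the cone. It does NOT give the box
part (`TentLawBox`) nor the wall part (`EndTentLaw`): those are separate hypotheses of the shape
theorem, route-irrelevant and removable by restating the crux to cone pairs. -/
def ClosedKinematics : Prop :=
  (∀ ω₂ lam β γ : ℝ, 0 < ω₂ → 0 < lam → 0 < β → 0 < γ → ∀ T : ℝ, 0 < T → ∀ a : ℝ, 0 < a → ∃ C : ℝ,
    ∀ (N k₁ k₂ d : ℕ) (τ : ℝ), k₁ ≤ k₂ → k₂ + 1 ≤ N → d ≤ k₁ → k₂ + d + 1 ≤ N → 0 ≤ τ → τ ≤ a * d →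
      Vw ω₂ lam β γ T N (blockInd N k₁ k₂) τ ≤ C * ((k₂ : ℝ) - k₁) * (N : ℝ) * partZ ω₂ lam β γ T N) →
  TentLawCone

/-- SHAPE (card `open-corrector-shadow`): contraction `‖∫₀^τ P_t J_B‖ = ‖u_B − P_τ u_B‖ ≤ 2‖u_B‖`
(NO decay of `P_t` is used — only that the equilibrium kernels contract `L²(μ_T)`), the cone
comparison (E1_block ⇒ E2 on cone pairs with bound C|B|N at every length), then the closed
kinematics (⇒ `TentLawCone`); the box and wall parts are the separate hypotheses `TentLawBox`,
`EndTentLaw`; finally `tentLaw_of_cone_box` and `subBallisticWindow_of_tents`. -/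
theorem subBallisticWindow_of_shadow :
    BlockConeScaleCorrector → OpenClosedCone → ClosedKinematics → TentLawBox → EndTentLaw →
      Summit.AtomisticToContinuum.FouriersLaw.Theses.OddSectorIrreversibility.SubBallisticWindow := by
  sorry

end

end Summit.AtomisticToContinuum.FouriersLaw.Cruxes.SubBallisticWindow.Ideator2
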